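/-
Copyright (c) 2026 the pub-hodgecm-mathlib formalisation cell (harness21).  Prover seat hodgecm-mathlib-K2E3-p32 (g4) (E3 hand on strike line L1, PAYER side of the
U1-glob TOP; LEAD F0P6-plan (g16) BATCH #265 (2) 2026-09-05T02:50:49Z), Track B «K2-LIT» ∕ hLiu418 = `stmt-HodgeConjecture-24832`: file F2a of the payer cut
(K2E3-p32 (g4) census 02:57:12Z) beneath K2E3-p23 (g9)'s TOP `K2LiuResidueVanishesOfPresentation` (#42F′ `slot_vanRes2E`).  THEOREMS ONLY (no `def`, no `instance`,
no notation, no named-fact hypothesis, no `sorry`); lane `--supports stmt-HodgeConjecture-24832 --as helper` (count-neutral).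
-/
import Summits.HodgeConjecture.HodgeConjecture.Theorems.K2LiuSWSectionPlaceFactorisation   -- ★ (S4-glob) (K2Liu-p03 g7): §1 `apply_zero_piSchwartzBruhatEquiv_tmul`, §2 `omega_cmDoubledWeilRep_tmul_choose`, §3 `omega_rDelta_tmul_choose`, `swSection_eq_omega_apply_zero`
import Summits.HodgeConjecture.HodgeConjecture.Theorems.K2LiuTensorEmbArchFinParts          -- ★ U2f (K2Liu-p08): `archPart_tensorEmb`, `finPart_tensorEmb`
import Literature.NumberTheory.K2Lit.SiegelWeilSectionTensor                              -- ★ O42.3b: `swSectionTensor`, `swSectionTensor_apply`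
import HarnessLib

/-!
# Crux `HLiu418`, U1-glob TOP (#42F′ `slot_vanRes2E`), payer file F2a: THE SIEGEL–WEIL SECTION OF A PURE TENSOR `Φ_∞ ⊗ f` SPLITS AS
# `F_∞(g_∞, Φ_∞) · F_f(g_f, f)` — ARCHIMEDEAN × FINITE, for a GENERAL finite-adelic Schwartz–Bruhat function `f`

Cell `hodgecm-mathlib`, crux item hLiu418 = `stmt-HodgeConjecture-24832`; squad K2, strike line L1, LEAD F0P6-plan (g16); TOP pen K2E3-p23 (g9)
(`Theorems/K2LiuResidueVanishesOfPresentation.lean :: resGen_eq_zero_of_presentation`, the Σ-shell over ★ END `K2LiuLocalKernelResidueVanishesArch.resGen_eq_zero_of_localKernel_arch`);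
payer K2E3-p32 (g4); U1 desk K2E3-p28 (g4); typist K2E3-typ3 (g3).

THE POINT.  The TOP's presentation binder writes the twisted Siegel–Weil family of `x ∈ D_V = span{E(a ⊗ Φ_f) : a ∈ V}` as a finite sum of families `stdExtension 𝒦 s₀ φ_j` whose
origin sections are PURE between the finite and the archimedean parts, `φ_j(h) = aφ_j(h_f) · b_j(h_∞)` (★ END's binder `hφ`, ★ (F-tail-arch) FILE 4's (3a) datum).  For a pure
tensor `E(a ⊗ f) = piSchwartzBruhatEquiv (a ⊗ₜ f)` this purity is the factorisation of the doubled Weil representation on pure tensors, which ★ (S4-glob)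
`K2LiuSWSectionPlaceFactorisation` proves operator by operator: `ω(s^𝔻 g)(Φ_∞ ⊗ f) = A_{g_∞}Φ_∞ ⊗ Ω(g_f) f` (§2 there, ★ `IsArchHalf.isArch` + ★ `omega_finSplitting_tmul`),
`ω(r(δ))(Ψ ⊗ f′) = A′Ψ ⊗ (⊗'_v M_v) f′` (§3 there, [Weil1964, n° 38–40]) and `(Ψ ⊗ f″)(0) = Ψ(0) · f″(0)` (§1 there).  Its ★ HEAD `exists_swSection_eq_mul_finprod_of_isDoubledWeilRep`
records only the EULER-PRODUCT form, for `f = ⊗_v Y_v` a restricted product of LOCAL functions; the TOP's generators carry an ARBITRARY `f ∈ 𝒮(𝔸_f^{n+n})`.  This file records the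
two-factor form for general `f` (same three ★ steps, no `piProdSB`), for ANY `χ`-normalised doubled Weil representation (uniqueness ★ `eq_cmDoubledWeilRep_of_isDoubledWeilRep`,
[Kudla1996, I §6 Lemma 6.3]), and reads it along the tensor embedding `h ↦ h ⊗ 1_{V′}` of ★ O42.3b `swSectionTensor` through ★ U2f `archPart_tensorEmb` ∕ `finPart_tensorEmb`
(`(h ⊗ 1)_∞` only sees `h_∞`, `(h ⊗ 1)_f` only sees `h_f`):
* §1 `exists_swSection_tmul_eq_mul_cm` — for the explicit representation `cmDoubledWeilRep χ hχ 𝔪 ha`: `∃ F_∞ F_f, ∀ g Φ_∞ f, f_{Φ_∞ ⊗ f}(g) = F_∞(g_∞, Φ_∞) · F_f(g_f, f)`;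
  **`exists_swSection_tmul_eq_mul`** — the same for ANY `sD` with `IsDoubledWeilRep χ sD` (`χ` unitary, `χ|_{𝕀_{L⁺}} = ε`).
* §2 **`exists_swSectionTensor_tmul_eq_mul`** — at the K2Lit tensor datum `(𝔻, V′ = ⟨dV′⟩)`: `∃ F_∞ F_f` on the SMALL group's archimedean ∕ finite-adelic points with
  `swSectionTensor s^B (E(Φ_∞ ⊗ f)) h = F_∞(h_∞, Φ_∞) · F_f(h_f, f)` for all `h ∈ H(𝔸)`, `Φ_∞`, `f`.
References: [Weil1964] A. Weil, Acta Math. 111 (1964), Chap. III n° 37–40; [KudlaRallis1994] S. Kudla, S. Rallis, Ann. of Math. 140 (1994), §1; [HarrisKudlaSweet1996]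
M. Harris, S. Kudla, W. J. Sweet, J. AMS 9 (1996), §1 (1.8), (1.11)–(1.16); [Kudla1996] S. Kudla, Castle Hill notes (1996), Chap. I §6 Lemma 6.3; [BorelJacquet1979] §4.1.
HONEST LABEL.  Count-neutral helper: `HC_CM` is proved only modulo the 7 printed citations (2 remaining named inputs: hLiu418 = `stmt-HodgeConjecture-24832`,
h413 = `stmt-HodgeConjecture-24833`) until rung 0 closes; U1-glob (#42F′ `slot_vanRes2E`) stays OPEN — this file is one payer brick beneath its TOP.
-/

set_option autoImplicit false
set_option linter.dupNamespace false -- the mandated namespace repeats `HodgeConjecture.HodgeConjecture`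

noncomputable section

open scoped Matrix TensorProduct Classical
open NumberField IsDedekindDomain Filter
open Literature.NumberTheory.Automorphic Literature.NumberTheory.Automorphic.UnitaryGroup Literature.NumberTheory.GaloisRepresentations
open Literature.NumberTheory.Weil1964 Literature.RepresentationTheory.HarrisKudlaSweet1996 Literature.RepresentationTheory.HeisenbergGroup
open Literature.NumberTheory.GelbartRogawski1991 Literature.NumberTheory.GelbartRogawski1991.GRConstruction
open Literature.NumberTheory.GelbartRogawski1991.UnitaryDualPair.LocalSplitting
open Literature.NumberTheory.K2Lit.SiegelDoubled
open Summit.HodgeConjecture.HodgeConjecture.Cruxes.HLiu418.K2LiuSWSectionPlaceFactorisation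
open Summit.HodgeConjecture.HodgeConjecture.Cruxes.HLiu418.K2LiuTensorEmbArchFinParts (archPart_tensorEmb finPart_tensorEmb)

namespace Summit.HodgeConjecture.HodgeConjecture.Cruxes.HLiu418.K2LiuSWSectionArchFinSplit

variable (L : Type) [Field L] [NumberField L] [IsCMField L]
variable {N M n : ℕ} (e : Fin N × Fin M ≃ Fin n)
  (dV : Fin N → L) (hdV : ∀ i, IsCMField.complexConj L (dV i) = dV i) (hdV0 : ∀ i, dV i ≠ 0)
  (dW : Fin M → L) (hdW : ∀ i, IsCMField.complexConj L (dW i) = dW i) (hdW0 : ∀ i, dW i ≠ 0)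

/-! ## §1 The Siegel–Weil section of `Φ_∞ ⊗ f` is an archimedean factor times a finite-adelic factor -/

section Doubled

variable (χ : HeckeCharacter L) (hχ : IsSplittingChar L 1 χ) (𝔪 : ∀ v, PlaceMeasure L v)
  {sa : UnitaryGroup.arch (Fp L) L (IsCMField.complexConj L) (n + n) (hermD L e dV hdV dW hdW) →* MpD L e dV hdV dW hdW}

/-- **`f_{Φ_∞ ⊗ f}(g) = F_∞(g_∞, Φ_∞) · F_f(g_f, f)` for the EXPLICIT representation `s^𝔻 = cmDoubledWeilRep χ hχ 𝔪 ha`** — with `F_∞(a, Φ_∞) := (A′(A_a Φ_∞))(0)`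
(the chosen archimedean operators of ★ `IsArchHalf.isArch` and of `r(δ)`) and `F_f(b, f) := ((⊗'_v M_v)(Ω(b) f))(0)`; three ★ (S4-glob) steps: `ω(r(δ)·s^𝔻 g) = ω(r(δ)) ∘ ω(s^𝔻 g)`,
`ω(s^𝔻 g)(Φ_∞ ⊗ f) = A_{g_∞}Φ_∞ ⊗ Ω(g_f) f`, `ω(r(δ))(Ψ ⊗ f′) = A′Ψ ⊗ (⊗'_v M_v) f′`, then `(Ψ ⊗ f″)(0) = Ψ(0)·f″(0)`.
[cite: Weil1964, Chap. III n° 38–40 pp. 190–191] [cite: HarrisKudlaSweet1996, §1 (1.11)–(1.16)] [cite: KudlaRallis1994, §1] -/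
theorem exists_swSection_tmul_eq_mul_cm (ha : IsArchHalf L e dV hdV hdV0 dW hdW hdW0 χ sa) :
    ∃ (Finf : UnitaryGroup.arch (Fp L) L (IsCMField.complexConj L) (n + n) (hermD L e dV hdV dW hdW) →
          SchwartzMap (Fin (n + n) → mixedEmbedding.mixedSpace (Fp L)) ℂ → ℂ)
      (Ffin : UnitaryGroup.finAdelic (Fp L) L (IsCMField.complexConj L) (n + n) (hermD L e dV hdV dW hdW) → FinSB (Fp L) (Fin (n + n)) → ℂ),
      ∀ (g : HA L e dV hdV dW hdW) (Φinf : SchwartzMap (Fin (n + n) → mixedEmbedding.mixedSpace (Fp L)) ℂ) (f : FinSB (Fp L) (Fin (n + n))),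
        swSection L e dV hdV hdV0 dW hdW hdW0 (cmDoubledWeilRep L e dV hdV hdV0 dW hdW hdW0 χ hχ 𝔪 ha)
            (piSchwartzBruhatEquiv (Fp L) (Fin (n + n)) (Φinf ⊗ₜ f)) g =
          Finf (UnitaryGroup.archPart (Fp L) L (IsCMField.complexConj L) (n + n) (hermD L e dV hdV dW hdW) g) Φinf *
            Ffin (UnitaryGroup.finPart (Fp L) L (IsCMField.complexConj L) (n + n) (hermD L e dV hdV dW hdW) g) f := by
  refine ⟨fun a Φinf => Classical.choose (exists_omega_rDelta_tmul L e dV hdV hdV0 dW hdW hdW0 χ 𝔪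
      (cmFinLocalFamily L e dV hdV hdV0 dW hdW hdW0 χ hχ 𝔪)) (Classical.choose (ha.isArch a) Φinf) 0,
    fun b f => ((piEquiv (deltaImpl L e dV hdV hdV0 dW hdW hdW0 χ 𝔪 (cmFinLocalFamily L e dV hdV hdV0 dW hdW hdW0 χ hχ 𝔪))
        (eventually_deltaImpl_unitVec L e dV hdV hdV0 dW hdW hdW0 χ 𝔪 (cmFinLocalFamily L e dV hdV hdV0 dW hdW hdW0 χ hχ 𝔪))
        ((finSplittings L e dV hdV hdV0 dW hdW hdW0 χ 𝔪 (cmFinLocalFamily L e dV hdV hdV0 dW hdW hdW0 χ hχ 𝔪)).Omega b f) : FinSB (Fp L) (Fin (n + n))) :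
          (Fin (n + n) → FiniteAdeleRing (𝓞 (Fp L)) (Fp L)) → ℂ) 0,
    fun g Φinf f => ?_⟩
  -- `ω(r(δ) · s^𝔻 g) Φ = ω(r(δ)) (ω(s^𝔻 g) Φ)`
  have hb := LinearMap.congr_fun (map_mul (adelicMpCont.omega (Fp L) (Fin (n + n)) (gramDA L e dV hdV dW hdW))
    (rDelta L e dV hdV hdV0 dW hdW hdW0) (cmDoubledWeilRep L e dV hdV hdV0 dW hdW hdW0 χ hχ 𝔪 ha g))
    (piSchwartzBruhatEquiv (Fp L) (Fin (n + n)) (Φinf ⊗ₜ f))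
  -- `ω(s^𝔻 g)(Φ_∞ ⊗ f) = A_{g_∞} Φ_∞ ⊗ Ω(g_f) f`
  have hc := omega_cmDoubledWeilRep_tmul_choose L e dV hdV hdV0 dW hdW hdW0 χ hχ 𝔪 ha g Φinf f
  -- `ω(r(δ))(Ψ ⊗ f′) = A′Ψ ⊗ (⊗'_v M_v) f′`
  have hd := omega_rDelta_tmul_choose L e dV hdV hdV0 dW hdW hdW0 χ 𝔪 (cmFinLocalFamily L e dV hdV hdV0 dW hdW hdW0 χ hχ 𝔪)
    (Classical.choose (ha.isArch (UnitaryGroup.archPart (Fp L) L (IsCMField.complexConj L) (n + n) (hermD L e dV hdV dW hdW) g)) Φinf)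
    ((finSplittings L e dV hdV hdV0 dW hdW hdW0 χ 𝔪 (cmFinLocalFamily L e dV hdV hdV0 dW hdW hdW0 χ hχ 𝔪)).Omega
      (UnitaryGroup.finPart (Fp L) L (IsCMField.complexConj L) (n + n) (hermD L e dV hdV dW hdW) g) f)
  -- assemble and evaluate at `0` (`Eq.trans` throughout, as in ★ (S4-glob) §4: `rw` on this goal makes the motive type-check time out)
  have key := congrArg (fun T : ↥(piSchwartzBruhat (Fp L) (Fin (n + n))) => (T : (Fin (n + n) → AdeleRing (𝓞 (Fp L)) (Fp L)) → ℂ) 0)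
    (hb.trans ((congrArg (adelicMpCont.omega (Fp L) (Fin (n + n)) (gramDA L e dV hdV dW hdW) (rDelta L e dV hdV hdV0 dW hdW hdW0)) hc).trans hd))
  exact (swSection_eq_omega_apply_zero L e dV hdV hdV0 dW hdW hdW0 _ _ g).trans (key.trans (apply_zero_piSchwartzBruhatEquiv_tmul (Fp L) (Fin (n + n)) _ _))

/-- **THE SIEGEL–WEIL SECTION OF A PURE TENSOR `Φ_∞ ⊗ f` IS AN ARCHIMEDEAN FACTOR TIMES A FINITE-ADELIC FACTOR**, for ANY `χ`-normalised doubled Weil representation `sD`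
(`χ` unitary with `χ|_{𝕀_{L⁺}} = ε`): there are `F_∞ : H(L⁺ ⊗ ℝ) → 𝓢((L⁺ ⊗ ℝ)^{n+n}) → ℂ` and `F_f : H(𝔸_f) → 𝒮(𝔸_f^{n+n}) → ℂ` with
`f_{Φ_∞ ⊗ f}(g) = swSection sD (E(Φ_∞ ⊗ f)) g = F_∞(g_∞, Φ_∞) · F_f(g_f, f)` for EVERY `g ∈ H(𝔸)`, every archimedean Schwartz function `Φ_∞` and every finite-adelic
Schwartz–Bruhat function `f` — by uniqueness `sD` is the explicit representation (★ `eq_cmDoubledWeilRep_of_isDoubledWeilRep`, ★ `exists_isArchHalf`), then §1.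
[cite: Kudla1996, Chap. I §6 Lemma 6.3] [cite: Weil1964, Chap. III n° 38–40 pp. 190–191] [cite: HarrisKudlaSweet1996, §1 (1.11)–(1.16)] [cite: KudlaRallis1994, §1] -/
theorem exists_swSection_tmul_eq_mul {χ : HeckeCharacter L} (hχu : χ.IsUnitary) (hχs : IsSplittingChar L 1 χ)
    {sD : HA L e dV hdV dW hdW →* MpD L e dV hdV dW hdW} (hsD : IsDoubledWeilRep L e dV hdV hdV0 dW hdW hdW0 χ sD) :
    ∃ (Finf : UnitaryGroup.arch (Fp L) L (IsCMField.complexConj L) (n + n) (hermD L e dV hdV dW hdW) →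
          SchwartzMap (Fin (n + n) → mixedEmbedding.mixedSpace (Fp L)) ℂ → ℂ)
      (Ffin : UnitaryGroup.finAdelic (Fp L) L (IsCMField.complexConj L) (n + n) (hermD L e dV hdV dW hdW) → FinSB (Fp L) (Fin (n + n)) → ℂ),
      ∀ (g : HA L e dV hdV dW hdW) (Φinf : SchwartzMap (Fin (n + n) → mixedEmbedding.mixedSpace (Fp L)) ℂ) (f : FinSB (Fp L) (Fin (n + n))),
        swSection L e dV hdV hdV0 dW hdW hdW0 sD (piSchwartzBruhatEquiv (Fp L) (Fin (n + n)) (Φinf ⊗ₜ f)) g =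
          Finf (UnitaryGroup.archPart (Fp L) L (IsCMField.complexConj L) (n + n) (hermD L e dV hdV dW hdW) g) Φinf *
            Ffin (UnitaryGroup.finPart (Fp L) L (IsCMField.complexConj L) (n + n) (hermD L e dV hdV dW hdW) g) f := by
  have ha := Classical.choose_spec (exists_isArchHalf L e dV hdV hdV0 dW hdW hdW0 χ hχu hχs)
  rw [eq_cmDoubledWeilRep_of_isDoubledWeilRep L e dV hdV hdV0 dW hdW hdW0 χ hχs (borelPlaceMeasure L) ha hsD]
  exact exists_swSection_tmul_eq_mul_cm L e dV hdV hdV0 dW hdW hdW0 χ hχs (borelPlaceMeasure L) ha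

end Doubled

/-! ## §2 At the tensor datum `(𝔻, V′)`: the Siegel–Weil section of `E(Φ_∞ ⊗ f)` along `h ↦ h ⊗ 1` splits over `h_∞`, `h_f` -/

section Tensor

variable {M₂ M' n' : ℕ} (eW : Fin M × Fin M₂ ≃ Fin M') (e' : Fin N × Fin M' ≃ Fin n')
  (dV' : Fin M₂ → L) (hdV' : ∀ k, IsCMField.complexConj L (dV' k) = dV' k) (hdV'0 : ∀ k, dV' k ≠ 0)

/-- **THE SIEGEL–WEIL SECTION OF THE `M₂`-SPACE `V′` AT A PURE TENSOR IS PURE BETWEEN `h_∞` AND `h_f`.**  For the tensor datum of ★ O42.3b (`s^B` any `χ`-normalised doubled Weil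
representation of the BIG datum `(e′, dV, dW ⊗ dV′)`, `χ` unitary with `χ|_{𝕀_{L⁺}} = ε`) there are `F_∞ : H(L⁺ ⊗ ℝ) → 𝓢 → ℂ` and `F_f : H(𝔸_f) → 𝒮(𝔸_f^{n′+n′}) → ℂ` on the SMALL
group `H = U(𝔻)` with `swSectionTensor s^B (E(Φ_∞ ⊗ f)) h = F_∞(h_∞, Φ_∞) · F_f(h_f, f)` for all `h`, `Φ_∞`, `f` — §1 on the big group at `h ⊗ 1`, read through ★ U2f
`archPart_tensorEmb` ∕ `finPart_tensorEmb`.  This is the purity `φ(h) = aφ(h_f) · b(h_∞)` of ★ END `resGen_eq_zero_of_localKernel_arch`'s datum `hφ` at a pure-tensor generator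
of a rigidity domain `D_V`. [cite: KudlaRallis1994, §1] [cite: HarrisKudlaSweet1996, §1 (1.8), (1.15)–(1.16)] [cite: BorelJacquet1979, §4.1] [cite: Weil1964, Chap. III n° 38–40 pp. 190–191] -/
theorem exists_swSectionTensor_tmul_eq_mul {χ : HeckeCharacter L} (hχu : χ.IsUnitary) (hχs : IsSplittingChar L 1 χ)
    {sB : HA L e' dV hdV (tensorFrame L dW eW dV') (tensorFrame_real L dW hdW eW dV' hdV') →*
      MpD L e' dV hdV (tensorFrame L dW eW dV') (tensorFrame_real L dW hdW eW dV' hdV')}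
    (hsB : IsDoubledWeilRep L e' dV hdV hdV0 (tensorFrame L dW eW dV') (tensorFrame_real L dW hdW eW dV' hdV')
      (tensorFrame_ne_zero L dW eW dV' hdW0 hdV'0) χ sB) :
    ∃ (Finf : UnitaryGroup.arch (Fp L) L (IsCMField.complexConj L) (n + n) (hermD L e dV hdV dW hdW) →
          SchwartzMap (Fin (n' + n') → mixedEmbedding.mixedSpace (Fp L)) ℂ → ℂ)
      (Ffin : UnitaryGroup.finAdelic (Fp L) L (IsCMField.complexConj L) (n + n) (hermD L e dV hdV dW hdW) → FinSB (Fp L) (Fin (n' + n')) → ℂ),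
      ∀ (h : HA L e dV hdV dW hdW) (Φinf : SchwartzMap (Fin (n' + n') → mixedEmbedding.mixedSpace (Fp L)) ℂ) (f : FinSB (Fp L) (Fin (n' + n'))),
        swSectionTensor L e dV hdV dW hdW eW e' dV' hdV' hdV0 hdW0 hdV'0 sB (piSchwartzBruhatEquiv (Fp L) (Fin (n' + n')) (Φinf ⊗ₜ f)) h =
          Finf (UnitaryGroup.archPart (Fp L) L (IsCMField.complexConj L) (n + n) (hermD L e dV hdV dW hdW) h) Φinf *
            Ffin (UnitaryGroup.finPart (Fp L) L (IsCMField.complexConj L) (n + n) (hermD L e dV hdV dW hdW) h) f := by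
  obtain ⟨Finf, Ffin, hF⟩ := exists_swSection_tmul_eq_mul L e' dV hdV hdV0 (tensorFrame L dW eW dV') (tensorFrame_real L dW hdW eW dV' hdV')
    (tensorFrame_ne_zero L dW eW dV' hdW0 hdV'0) hχu hχs hsB
  refine ⟨fun a Φinf => Finf (UnitaryGroup.archPart (Fp L) L (IsCMField.complexConj L) (n' + n') (hermD L e' dV hdV (tensorFrame L dW eW dV') (tensorFrame_real L dW hdW eW dV' hdV'))
      (tensorEmb L e dV hdV dW hdW eW e' dV' hdV' (UnitaryGroup.archToAdelic (Fp L) L (IsCMField.complexConj L) (n + n) (hermD L e dV hdV dW hdW) a))) Φinf,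
    fun b f => Ffin (UnitaryGroup.finPart (Fp L) L (IsCMField.complexConj L) (n' + n') (hermD L e' dV hdV (tensorFrame L dW eW dV') (tensorFrame_real L dW hdW eW dV' hdV'))
      (tensorEmb L e dV hdV dW hdW eW e' dV' hdV' (UnitaryGroup.finAdelicToAdelic (Fp L) L (IsCMField.complexConj L) (n + n) (hermD L e dV hdV dW hdW) b))) f,
    fun h Φinf f => ?_⟩
  rw [swSectionTensor_apply, hF, archPart_tensorEmb, finPart_tensorEmb]

end Tensor

end Summit.HodgeConjecture.HodgeConjecture.Cruxes.HLiu418.K2LiuSWSectionArchFinSplit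

end
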